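import Literature.AnabelianGeometry.EtaleTheta.TemperedFrobenioidOfTateTowerTheta
import Literature.AnabelianGeometry.EtaleTheta.TemperedFrobenioidCoprimePull
import HarnessLib

/-!
# [EtTh] Def. 3.6 (ii) / Def. 4.1 (i): the coprimality-pull-back law `hDSpull` (`TemperedFrobenioid.CoprimePullLaw`) HOLDS at the
# tempered Frobenioid of the `Ÿ`-skeleton with cusps and theta (and at every tf built by the pattern engine from support-respecting
# transitions) — R822 file C (proof-only)

S. Mochizuki, *The étale theta function …*, Publ. RIMS **45** (2009) [MochizukiEtTh2009], Def. 3.1 (i) p.70, Def. 3.3 (iii) p.73, Def. 3.6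
(ii) p.76–77, §4 Def. 4.1 (i) p.86 («`Div(s′)`, `Div(s″)` have disjoint supports [cf. [FrdI], Proposition 4.1, (iii)]»), proof of Prop. 4.2
(iii) pp.89–90 [cite: MochizukiEtTh2009, Def 4.1 (i) p.86]; [FrdI] = [MochizukiFrdI2008] §0 p.11 (`M^pf`), Def. 2.4 (i) p.47.

abc-iut cell, layer L2 [EtTh]; seat abc-iut-L2-t3 (gen 7), row R822 «DIAGONALBASE′ + TF OVER TATETOWERTHETA», file C (PROOF-ONLY, 0 defs).
Consumed BY NAME: the predicate of record `TemperedFrobenioid.CoprimePullLaw` (p466773, = GAP G-w5d063-1's binder `hDSpull`), this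
seat's pattern engine `ofGenDiagonalBase` (p480926) and `Ÿ`-skeleton tf `ThetaTowerTempered.temperedFrobenioid` (file B), the
coordinate calculus `TateTowerTheta.coord / dvd_iff_toAdd_coord_le / coprime_iff_coord` (p478021).
* §1 the transfer from the perfections for the PATTERN engine (`GenDiagonalBase.coprimePullLaw_of_perfection`; the argument of
  `coprimePullLaw_ofDiagonalBase_of_perfection`, p468312, verbatim for `ofGenDiagonalBase`);
* §2 coprimality of classes in `Φ₀(S)^pf` at the `Ÿ`-skeleton = disjointness of the COORDINATE SUPPORTS of representatives, cusps AND
  components (`perfection_coprime_iff_coord`), and coprime-preservation for any support-respecting monoid map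
  (`perfection_map_coprime`; pull-backs along `Γ`-maps are such, `phiZeroPull_disjoint`);
* §3 **`ThetaTowerTempered.coprimePullLaw X φ R S : (temperedFrobenioid X φ R S).CoprimePullLaw`** — REGISTER ✓ at the `Ÿ`-skeleton tf
  (every tempered `X`, every character `φ`), + the consumers' binder shape `hDSpull_temperedFrobenioid`.
HONEST FRAMING: theorems about OUR typed interfaces at a combinatorial skeleton; nothing here bears on [IUTchIII] Cor. 3.12; no side
taken; typed ≠ proved — here proved.
-/

noncomputable section

namespace Literature.AnabelianGeometry.EtaleTheta

open CategoryTheory Opposite Function Literature.AlgebraicGeometry.Frobenioids Literature.AnabelianGeometry.SemiGraphs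
  LogDivisorModel LogDivisorModel.GaloisAction

universe u₀ v₀ u v

/-! ## §1 The transfer from the perfections, for the pattern engine -/

namespace TemperedFrobenioid.GenDiagonalBase

variable {D₀ : Type u₀} [Category.{v₀} D₀] {dm : DivisorMonoids.{u₀, v₀, 0} D₀}
  (hpf : ∀ Y : D₀ᵒᵖ, IsPerfFactorialCof (dm.Φ₀.obj Y)) {D : Type u} [Category.{v} D] (P : GenDiagonalBase dm D)
  (hD : IsConnected D) (hD' : IsTotallyEpimorphic D) (hFSM : IsOfFSMType D) (R S : (Dᵒᵖ ⥤ CommMonCat.{0}) → Prop)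

/-- Every element of `Φ(A)` is the class of an element of `Φ₀(F A)^pf`. [cite: MochizukiFrdI2008, Def. 2.4(i) p.47] -/
theorem exists_eq_toRealification (A : Dᵒᵖ) (a : (ofGenDiagonalBase hpf P hD hD' hFSM R S).Φ.carrier A) :
    ∃ α : Perfection (dm.Φ₀.obj (op (P.F.obj A.unop))), (hpf (op (P.F.obj A.unop))).weak.toRealification α = a.1 :=
  a.2

/-- Divisibility in `Φ(A)` forces divisibility in `Φ₀(F A)^pf` (`M^pf → M^rlf` injective). [cite: MochizukiFrdI2008, Def. 2.4(i) p.47] -/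
theorem dvd_of_toRealification_dvd (A : Dᵒᵖ) (α β : Perfection (dm.Φ₀.obj (op (P.F.obj A.unop))))
    (a b : (ofGenDiagonalBase hpf P hD hD' hFSM R S).Φ.carrier A) (ha : (hpf (op (P.F.obj A.unop))).weak.toRealification α = a.1)
    (hb : (hpf (op (P.F.obj A.unop))).weak.toRealification β = b.1) (h : a ∣ b) : α ∣ β := by
  obtain ⟨c, hc⟩ := h
  obtain ⟨γ, hγ⟩ := exists_eq_toRealification hpf P hD hD' hFSM R S A c
  refine ⟨γ, PfImageWeak.toRealification_injective (hpf (op (P.F.obj A.unop))).weak ?_⟩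
  rw [map_mul, ha, hγ, hb]
  exact congrArg Subtype.val hc

/-- Divisibility in `Φ₀(F A)^pf` gives divisibility in `Φ(A)`. [cite: MochizukiFrdI2008, Def. 2.4(i) p.47] -/
theorem toRealification_dvd_of_dvd (A : Dᵒᵖ) (α β : Perfection (dm.Φ₀.obj (op (P.F.obj A.unop))))
    (a b : (ofGenDiagonalBase hpf P hD hD' hFSM R S).Φ.carrier A) (ha : (hpf (op (P.F.obj A.unop))).weak.toRealification α = a.1)
    (hb : (hpf (op (P.F.obj A.unop))).weak.toRealification β = b.1) (h : α ∣ β) : a ∣ b := by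
  obtain ⟨γ, rfl⟩ := h
  refine ⟨⟨(hpf (op (P.F.obj A.unop))).weak.toRealification γ, γ, rfl⟩, Subtype.ext ?_⟩
  have hm : (hpf (op (P.F.obj A.unop))).weak.toRealification (α * γ) =
      (hpf (op (P.F.obj A.unop))).weak.toRealification α * (hpf (op (P.F.obj A.unop))).weak.toRealification γ := map_mul _ _ _
  rw [hb, ha] at hm
  exact hm

/-- The pull-back of `Φ` along `f : B ⟶ A` is `Φ₀(F f)^pf` on representatives. [cite: MochizukiEtTh2009, Def 3.6 p.76] -/
theorem coe_pull {A B : D} (f : B ⟶ A) (α : Perfection (dm.Φ₀.obj (op (P.F.obj A))))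
    (a : (ofGenDiagonalBase hpf P hD hD' hFSM R S).Φ.carrier (op A)) (ha : (hpf (op (P.F.obj A))).weak.toRealification α = a.1) :
    (hpf (op (P.F.obj B))).weak.toRealification (Literature.AlgebraicGeometry.Frobenioids.Perfection.map (dm.Φ₀.map (P.F.map f).op).hom α) =
      (pull (ofGenDiagonalBase hpf P hD hD' hFSM R S).divisorMonoid f a).1 := by
  have h := DFunLike.congr_fun (rlfMapWeak_comp_toRealification dm.Φ₀ hpf (P.F.map f).op) α
  simp only [MonoidHom.comp_apply] at h
  rw [ha] at h
  exact h.symm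

/-- **The coprimality-pull-back law for the pattern engine, transferred from the perfections**: if along every arrow `f : B ⟶ A` the
pull-back `Φ₀(F f)^pf` carries coprime pairs to coprime pairs, then `ofGenDiagonalBase …` satisfies `CoprimePullLaw`.
[cite: MochizukiEtTh2009, Def 4.1 (i) p.86] -/
theorem coprimePullLaw_of_perfection
    (H : ∀ {A B : D} (f : B ⟶ A) (α β : Perfection (dm.Φ₀.obj (op (P.F.obj A)))),
      (∀ ξ : Perfection (dm.Φ₀.obj (op (P.F.obj A))), ξ ∣ α → ξ ∣ β → ξ = 1) →
        ∀ η : Perfection (dm.Φ₀.obj (op (P.F.obj B))), η ∣ Literature.AlgebraicGeometry.Frobenioids.Perfection.map (dm.Φ₀.map (P.F.map f).op).hom α →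
          η ∣ Literature.AlgebraicGeometry.Frobenioids.Perfection.map (dm.Φ₀.map (P.F.map f).op).hom β → η = 1) :
    (ofGenDiagonalBase hpf P hD hD' hFSM R S).CoprimePullLaw := by
  intro A B f a b hab y hya hyb
  obtain ⟨α, hα⟩ := exists_eq_toRealification hpf P hD hD' hFSM R S (op A) a
  obtain ⟨β, hβ⟩ := exists_eq_toRealification hpf P hD hD' hFSM R S (op A) b
  obtain ⟨η, hη⟩ := exists_eq_toRealification hpf P hD hD' hFSM R S (op B) y
  have hαβ : ∀ ξ : Perfection (dm.Φ₀.obj (op (P.F.obj A))), ξ ∣ α → ξ ∣ β → ξ = 1 := by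
    intro ξ hξα hξβ
    have hx : (⟨(hpf (op (P.F.obj A))).weak.toRealification ξ, ξ, rfl⟩ :
        (ofGenDiagonalBase hpf P hD hD' hFSM R S).Φ.carrier (op A)) = 1 :=
      hab _ (toRealification_dvd_of_dvd hpf P hD hD' hFSM R S (op A) ξ α _ a rfl hα hξα)
        (toRealification_dvd_of_dvd hpf P hD hD' hFSM R S (op A) ξ β _ b rfl hβ hξβ)
    refine PfImageWeak.toRealification_injective (hpf (op (P.F.obj A))).weak ?_
    rw [map_one]
    exact congrArg Subtype.val hx
  have hηα : η ∣ Literature.AlgebraicGeometry.Frobenioids.Perfection.map (dm.Φ₀.map (P.F.map f).op).hom α :=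
    dvd_of_toRealification_dvd hpf P hD hD' hFSM R S (op B) η _ y _ hη (coe_pull hpf P hD hD' hFSM R S f α a hα) hya
  have hηβ : η ∣ Literature.AlgebraicGeometry.Frobenioids.Perfection.map (dm.Φ₀.map (P.F.map f).op).hom β :=
    dvd_of_toRealification_dvd hpf P hD hD' hFSM R S (op B) η _ y _ hη (coe_pull hpf P hD hD' hFSM R S f β b hβ) hyb
  have hη1 : η = 1 := H f α β hαβ η hηα hηβ
  apply Subtype.ext
  change y.1 = 1
  rw [← hη, hη1, map_one]
  rfl

end TemperedFrobenioid.GenDiagonalBase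

/-! ## §2 Coprimality in `Φ₀(S)^pf` at the `Ÿ`-skeleton: disjoint coordinate supports (cusps AND components) -/

namespace LogDivisorModel.TateTowerTheta

variable {Γ : Type} [Group Γ] (φ : Γ →* Multiplicative ℤ) (S : Action (Type 0) Γ)

/-- Same-index divisibility in a perfection: `x ∣ a ⇒ x^{1/n} ∣ a^{1/n}`. [cite: MochizukiFrdI2008, §0 p.11] -/
theorem perfection_mk_dvd_mk_of_dvd {M : Type} [CommMonoid M] {x a : M} (h : x ∣ a) (n : ℕ+) : Literature.AlgebraicGeometry.Frobenioids.Perfection.mk x n ∣ Literature.AlgebraicGeometry.Frobenioids.Perfection.mk a n := by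
  obtain ⟨c, rfl⟩ := h
  exact ⟨Literature.AlgebraicGeometry.Frobenioids.Perfection.mk c n, by rw [Literature.AlgebraicGeometry.Frobenioids.Perfection.mk_mul_mk, ← mul_pow, Literature.AlgebraicGeometry.Frobenioids.Perfection.mk_pow_mul]⟩

/-- Divisibility of classes unwinds to divisibility of powers: `x^{1/k} ∣ a^{1/n} ⇒ x^p ∣ a^q`, `p ≥ 1`. [cite: MochizukiFrdI2008, §0 p.11] -/
theorem perfection_exists_pow_dvd_pow {M : Type} [CommMonoid M] {x a : M} {k n : ℕ+} (h : Literature.AlgebraicGeometry.Frobenioids.Perfection.mk x k ∣ Literature.AlgebraicGeometry.Frobenioids.Perfection.mk a n) :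
    ∃ p q : ℕ, 0 < p ∧ x ^ p ∣ a ^ q := by
  obtain ⟨w, hw⟩ := h
  obtain ⟨⟨c, j⟩, rfl⟩ := Literature.AlgebraicGeometry.Frobenioids.Perfection.mk_surjective w
  change Literature.AlgebraicGeometry.Frobenioids.Perfection.mk a n = Literature.AlgebraicGeometry.Frobenioids.Perfection.mk x k * Literature.AlgebraicGeometry.Frobenioids.Perfection.mk c j at hw
  rw [Literature.AlgebraicGeometry.Frobenioids.Perfection.mk_mul_mk, Literature.AlgebraicGeometry.Frobenioids.Perfection.mk_eq_mk_iff] at hw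
  obtain ⟨N, hN⟩ := hw
  refine ⟨(j : ℕ) * ((N : ℕ) * (n : ℕ)), (N : ℕ) * ((k * j : ℕ+) : ℕ), Nat.mul_pos j.pos (Nat.mul_pos N.pos n.pos),
    c ^ ((k : ℕ) * ((N : ℕ) * (n : ℕ))), ?_⟩
  rw [hN, mul_pow, ← pow_mul, ← pow_mul]

/-- An element of `Φ₀(S)` all of whose coordinates vanish is trivial. [cite: MochizukiEtTh2009, Def 3.1 p.70] -/
theorem eq_one_of_coord_eq_one {ψ : (action φ).phiZero S} (h : ∀ (s : S.V) (x : Idx), coord φ S s x ψ = 1) : ψ = 1 :=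
  coord_separating φ S fun s x => by rw [h s x, map_one]

/-- Coordinates of powers vanish exactly where the coordinates vanish (`k ≥ 1`). [cite: MochizukiEtTh2009, Def 3.1 p.70] -/
theorem coord_pow_eq_one_iff {k : ℕ} (hk : 0 < k) (s : S.V) (x : Idx) (ψ : (action φ).phiZero S) :
    coord φ S s x (ψ ^ k) = 1 ↔ coord φ S s x ψ = 1 := by
  rw [map_pow]
  constructor
  · intro h
    have h1 := congrArg Multiplicative.toAdd h
    rw [toAdd_pow, toAdd_one, smul_eq_mul, Nat.mul_eq_zero] at h1
    rcases h1 with h0 | h0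
    · exact absurd h0 hk.ne'
    · exact Multiplicative.toAdd.injective (by rw [h0, toAdd_one])
  · intro h
    rw [h, one_pow]

/-- Positive powers are injective on `Φ₀(S)`. [cite: MochizukiEtTh2009, Def 3.3 p.73] -/
theorem pow_left_injective {k : ℕ} (hk : 0 < k) : Injective fun ψ : (TateTowerTheta.action φ).phiZero S => ψ ^ k := fun ψ ψ' h =>
  coord_separating φ S fun s x => by
    have h1 : coord φ S s x (ψ ^ k) = coord φ S s x (ψ' ^ k) := congrArg (fun χ => coord φ S s x χ) h
    rw [map_pow, map_pow] at h1
    apply Multiplicative.toAdd.injective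
    have h2 := congrArg Multiplicative.toAdd h1
    rw [toAdd_pow, toAdd_pow, smul_eq_mul, smul_eq_mul] at h2
    exact Nat.eq_of_mul_eq_mul_left hk h2

/-- If a positive power of `y` divides a power of `a`, the support of `y` lies in that of `a`. [cite: MochizukiEtTh2009, Def 3.1 p.70] -/
theorem coord_eq_one_of_pow_dvd_pow {y a : (action φ).phiZero S} {p q : ℕ} (hp : 0 < p) (h : y ^ p ∣ a ^ q) (s : S.V) (x : Idx)
    (ha : coord φ S s x a = 1) : coord φ S s x y = 1 := by
  have h1 := toAdd_coord_le_of_dvd φ S h s x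
  rw [map_pow (coord φ S s x) a, ha, one_pow, toAdd_one, Nat.le_zero] at h1
  exact (coord_pow_eq_one_iff φ S hp s x y).mp (Multiplicative.toAdd.injective (by rw [h1, toAdd_one]))

/-- **Coprimality of classes in `Φ₀(S)^pf` is disjointness of the coordinate supports of the representatives** (cusps and
components alike). [cite: MochizukiEtTh2009, Def 4.1 (i) p.86] -/
theorem perfection_coprime_iff_coord (a b : (action φ).phiZero S) (k m : ℕ+) :
    (∀ ξ : Perfection ((action φ).phiZero S), ξ ∣ Literature.AlgebraicGeometry.Frobenioids.Perfection.mk a k → ξ ∣ Literature.AlgebraicGeometry.Frobenioids.Perfection.mk b m → ξ = 1) ↔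
      ∀ (s : S.V) (x : Idx), coord φ S s x a = 1 ∨ coord φ S s x b = 1 := by
  constructor
  · intro h
    refine (coprime_iff_coord φ S a b).mp fun ξ hξa hξb => ?_
    have h1 : Literature.AlgebraicGeometry.Frobenioids.Perfection.mk ξ (k * m) ∣ Literature.AlgebraicGeometry.Frobenioids.Perfection.mk a k := by
      rw [← Literature.AlgebraicGeometry.Frobenioids.Perfection.mk_pow_mul a k m]
      exact perfection_mk_dvd_mk_of_dvd (hξa.trans (dvd_pow_self a m.ne_zero)) _
    have h2 : Literature.AlgebraicGeometry.Frobenioids.Perfection.mk ξ (k * m) ∣ Literature.AlgebraicGeometry.Frobenioids.Perfection.mk b m := by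
      rw [← Literature.AlgebraicGeometry.Frobenioids.Perfection.mk_pow_mul b m k, mul_comm k m]
      exact perfection_mk_dvd_mk_of_dvd (hξb.trans (dvd_pow_self b k.ne_zero)) _
    obtain ⟨N, hN⟩ := Literature.AlgebraicGeometry.Frobenioids.Perfection.mk_eq_one_iff.mp (h _ h1 h2)
    exact pow_left_injective φ S N.pos (show ξ ^ (N : ℕ) = 1 ^ (N : ℕ) by rw [hN, one_pow])
  · intro h ξ hξa hξb
    obtain ⟨⟨y, j⟩, rfl⟩ := Literature.AlgebraicGeometry.Frobenioids.Perfection.mk_surjective ξ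
    obtain ⟨p, q, hp, hpq⟩ := perfection_exists_pow_dvd_pow hξa
    obtain ⟨p', q', hp', hpq'⟩ := perfection_exists_pow_dvd_pow hξb
    have hy : y = 1 := eq_one_of_coord_eq_one φ S fun s x => by
      rcases h s x with h0 | h0
      · exact coord_eq_one_of_pow_dvd_pow φ S hp hpq s x h0
      · exact coord_eq_one_of_pow_dvd_pow φ S hp' hpq' s x h0
    change Literature.AlgebraicGeometry.Frobenioids.Perfection.mk y j = 1
    rw [hy, Literature.AlgebraicGeometry.Frobenioids.Perfection.mk_one]

/-- **A monoid map `Φ₀(S′) → Φ₀(S)` carrying support-disjoint pairs to support-disjoint pairs induces a COPRIME-PRESERVING map of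
perfections.** [cite: MochizukiEtTh2009, Def 4.1 (i) p.86] -/
theorem perfection_map_coprime {S' : Action (Type 0) Γ} (F : (action φ).phiZero S' →* (action φ).phiZero S)
    (hF : ∀ a b : (action φ).phiZero S', (∀ (s : S'.V) (x : Idx), coord φ S' s x a = 1 ∨ coord φ S' s x b = 1) →
      ∀ (s : S.V) (x : Idx), coord φ S s x (F a) = 1 ∨ coord φ S s x (F b) = 1)
    (α β : Perfection ((action φ).phiZero S')) (hαβ : ∀ ξ : Perfection ((action φ).phiZero S'), ξ ∣ α → ξ ∣ β → ξ = 1)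
    (η : Perfection ((action φ).phiZero S)) (hηα : η ∣ Literature.AlgebraicGeometry.Frobenioids.Perfection.map F α) (hηβ : η ∣ Literature.AlgebraicGeometry.Frobenioids.Perfection.map F β) : η = 1 := by
  obtain ⟨⟨a, k⟩, rfl⟩ := Literature.AlgebraicGeometry.Frobenioids.Perfection.mk_surjective α
  obtain ⟨⟨b, m⟩, rfl⟩ := Literature.AlgebraicGeometry.Frobenioids.Perfection.mk_surjective β
  change η ∣ Literature.AlgebraicGeometry.Frobenioids.Perfection.map F (Literature.AlgebraicGeometry.Frobenioids.Perfection.mk a k) at hηα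
  change η ∣ Literature.AlgebraicGeometry.Frobenioids.Perfection.map F (Literature.AlgebraicGeometry.Frobenioids.Perfection.mk b m) at hηβ
  rw [Literature.AlgebraicGeometry.Frobenioids.Perfection.map_mk] at hηα hηβ
  exact (perfection_coprime_iff_coord φ S (F a) (F b) k m).mpr (hF a b ((perfection_coprime_iff_coord φ S' a b k m).mp hαβ)) η hηα hηβ

/-- Pull-back along a map of `Γ`-sets, on coordinates: `coord s x (f^* ψ) = coord (f s) x ψ`. [cite: MochizukiEtTh2009, Def 3.3 p.73] -/
theorem coord_phiZeroPull {S' : Action (Type 0) Γ} (f : S ⟶ S') (s : S.V) (x : Idx) (ψ : (action φ).phiZero S') :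
    coord φ S s x ((action φ).phiZeroPull f ψ) = coord φ S' (f.hom s) x ψ := rfl

/-- Pull-back along any map of `Γ`-sets carries support-disjoint pairs to support-disjoint pairs. [cite: MochizukiEtTh2009, Def 4.1 (i) p.86] -/
theorem phiZeroPull_disjoint {S' : Action (Type 0) Γ} (f : S ⟶ S') (a b : (action φ).phiZero S')
    (h : ∀ (s : S'.V) (x : Idx), coord φ S' s x a = 1 ∨ coord φ S' s x b = 1) (s : S.V) (x : Idx) :
    coord φ S s x ((action φ).phiZeroPull f a) = 1 ∨ coord φ S s x ((action φ).phiZeroPull f b) = 1 := by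
  rw [coord_phiZeroPull, coord_phiZeroPull]
  exact h _ x

end LogDivisorModel.TateTowerTheta

/-! ## §3 REGISTER ✓ at the `Ÿ`-skeleton tempered Frobenioid over `B^temp(Π^tp_X)⁰` -/

namespace ThetaTowerTempered

variable {K : Type} [Field K] (X : SemiGraphs.TemperedArithmeticGroup.{0} K) (φ : X.Pi →* Multiplicative ℤ)

/-- The transitions of `Φ₀` of the `Ÿ`-skeleton data over `CosetCat Π^tp_X` ARE pull-backs along the coset maps.
[cite: MochizukiEtTh2009, Def 3.3 (iii) p.73] -/
theorem Φ₀_map_hom_apply {Y Y' : (CosetCat X.Pi)ᵒᵖ} (g : Y ⟶ Y') (ψ : (dm X φ).Φ₀.obj Y) :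
    ((dm X φ).Φ₀.map g).hom ψ = (TateTowerTheta.action φ).phiZeroPull ((CosetCat.toBTemp X.isTempered).map g.unop).hom ψ := rfl

/-- Along every covering map the transition of `Φ₀` carries support-disjoint pairs to support-disjoint pairs.
[cite: MochizukiEtTh2009, Def 4.1 (i) p.86] -/
theorem Φ₀_map_disjoint {A B : ConnectedPart (BTemp X.Pi)} (f : B ⟶ A) (a b : (dm X φ).Φ₀.obj (op ((genDiagonalBase X φ).F.obj A)))
    (h : ∀ (s : (gset X A).V) (x : TateTowerTheta.Idx),
      TateTowerTheta.coord φ (gset X A) s x a = 1 ∨ TateTowerTheta.coord φ (gset X A) s x b = 1)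
    (s : (gset X B).V) (x : TateTowerTheta.Idx) :
    TateTowerTheta.coord φ (gset X B) s x (((dm X φ).Φ₀.map ((genDiagonalBase X φ).F.map f).op).hom a) = 1 ∨
      TateTowerTheta.coord φ (gset X B) s x (((dm X φ).Φ₀.map ((genDiagonalBase X φ).F.map f).op).hom b) = 1 := by
  rw [Φ₀_map_hom_apply, Φ₀_map_hom_apply]
  exact TateTowerTheta.phiZeroPull_disjoint φ _ _ a b h s x

variable (R S : ((ConnectedPart (BTemp X.Pi))ᵒᵖ ⥤ CommMonCat.{0}) → Prop)

/-- **REGISTER ✓ — the coprimality-pull-back law `hDSpull` HOLDS at the tempered Frobenioid of the `Ÿ`-skeleton over `B^temp(Π^tp_X)⁰`**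
(every tempered `X`, every character `φ`): disjoint supports — cusps and components — pull back to disjoint supports, and the law transfers
from the perfections. [cite: MochizukiEtTh2009, Def 4.1 (i) p.86] -/
theorem coprimePullLaw : (ThetaTowerTempered.temperedFrobenioid X φ R S).CoprimePullLaw :=
  TemperedFrobenioid.GenDiagonalBase.coprimePullLaw_of_perfection (hpf X φ) (genDiagonalBase X φ) _ _ _ R S
    fun f α β hαβ η hηα hηβ =>
      TateTowerTheta.perfection_map_coprime φ _ _ (fun a b h => Φ₀_map_disjoint X φ f a b h) α β hαβ η hηα hηβ

/-- The law in the consumers' binder shape (`hDSpull` of the Prop. 4.2 (iii)/(iv) law-level closers) at the `Ÿ`-skeleton setting.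
[cite: MochizukiEtTh2009, Prop 4.2 (iii) p.89] -/
theorem hDSpull_temperedFrobenioid {A A' : ConnectedPart (BTemp X.Pi)} (e : A' ⟶ A)
    {a b : (temperedFrobenioid X φ R S).Φ.carrier (op A)}
    (hab : ∀ x : (temperedFrobenioid X φ R S).Φ.carrier (op A), x ∣ a → x ∣ b → x = 1)
    (y : (temperedFrobenioid X φ R S).Φ.carrier (op A')) (hya : y ∣ pull (temperedFrobenioid X φ R S).divisorMonoid e a)
    (hyb : y ∣ pull (temperedFrobenioid X φ R S).divisorMonoid e b) : y = 1 :=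
  coprimePullLaw X φ R S e hab y hya hyb

end ThetaTowerTempered

end Literature.AnabelianGeometry.EtaleTheta

end
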